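import Literature.Geometry.Lorentzian.SchwarzschildStaticCauchyTime
import Literature.Geometry.Lorentzian.SchwarzschildKerrSchildRicciFlat
import Literature.Geometry.Lorentzian.KerrDataSchwarzschildExtrinsic
import Literature.Geometry.Lorentzian.KerrStationaryBlackHole
import Literature.Geometry.Lorentzian.ChartSecondFundamentalForm
import Literature.Geometry.Lorentzian.CurvatureNaturality
import Literature.Geometry.Lorentzian.CauchyDevelopment
import HarnessLib

/-!
# The static Schwarzschild exterior is a vacuum Cauchy development of its time-symmetric slice
# (positive mass), and inhabits the typed quasi-final late-chart clauses at the development level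

B. O'Neill, *Semi-Riemannian geometry with applications to relativity*, Academic Press 1983, Ch. 13
(Def. 13.2: the Schwarzschild exterior `N = P_I ×_r S²`, `r > 2M`; "Schwarzschild observers": `N` is
time-oriented by the static Killing field `∂_t`) and Ch. 14 (Def. 14.28, p. 415: Cauchy hypersurface;
Exercise 14.6: "the Schwarzschild exterior `N` … [is] globally hyperbolic"); R. M. Wald, *General
Relativity*, Chicago 1984, §6.1 (static observers) and §10.2 (time-symmetric initial data: the second
fundamental form of a static slice vanishes, `K_{ab} = 0`); H. Ringström, *The Cauchy Problem in General
Relativity*, EMS 2009, Def. 16.2–16.3 (globally hyperbolic / vacuum developments of initial data);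
A. Ellithy, *The spacetime Penrose inequality under a quasi final state hypothesis*, arXiv:2605.18730
(2026), §4.1 (p. 38), Def. 4.4 (p. 39), Remark 4.6 (p. 40: "the stationary Kerr and Schwarzschild
exteriors are compatible with the final-state hypotheses").

`SchwarzschildStaticLateChart` and `SchwarzschildStaticCauchyTime` put every typed clause of the quasi
final state hypothesis (Def. 4.4 (1)+(2), the §4.1 rest frame, the collar sentence, the orientation
clause) on the tree's Schwarzschild exterior in STATIC coordinates, the time-oriented Lorentzian manifold
`(Kerr.exterior M 0, Schwarzschild.staticMetric M, Schwarzschild.staticTimeOrientation M)` — at the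
MANIFOLD level.  The consumers of the typed hypothesis (a `FrameProperty`, an analytic property of a late
exterior chart of a development) quantify over a Cauchy development `𝒟 : CauchyDevelopment D` resp. a
vacuum one, `𝒟 : VacuumCauchyDevelopment D` (`CauchyDevelopment.lean`; Ringström 2009, Def. 16.2–16.3),
of initial data `D` on a connected `3`-manifold.  This module packages the positive-mass static exterior
as such a development — every field a theorem of the tree, no named fact — and restates the typed
clauses over it, exactly as `MinkowskiLateChart` (§ Development level) does for the flat model
`𝒟₀ := Minkowski.vacuumCauchyDevelopment`:

* `Schwarzschild.staticSliceEmbed M : Kerr.slice 0 r₊ → Kerr.exterior M 0`, `y ↦ (0, y)` — the prelude's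
  slice embedding `Kerr.sliceEmbed 0 r₊` with the carrier spelled `Kerr.exterior M 0 = Kerr.region 0 r₊`
  (the slice `{t = 0}`, `‖y‖ > 2M`, of the static chart; O'Neill Def. 13.2); a smooth embedding
  (`Kerr.isSmoothEmbedding_sliceEmbed_holds`), with image the level `{t = 0}`
  (`range_staticSliceEmbed`), hence a CAUCHY HYPERSURFACE of the static chart for `0 < M`
  (`isCauchyHypersurface_range_staticSliceEmbed`, from `Schwarzschild.isCauchyHypersurface_level_time`);
* `Schwarzschild.staticSliceNormal M` — the future unit normal `N = (1 − 2M/r)^{-1/2} ∂_t` (the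
  normalised static Killing field; Wald §6.1, §10.2), `isFutureUnitNormal_staticSliceNormal`;
* `Schwarzschild.isSpacelikeImmersion_staticSliceEmbed` (`0 ≤ M`) and the TIME-SYMMETRIC DATA
  `Schwarzschild.staticSliceData M hM : InitialDataSet 𝓘(ℝ, E3) (Kerr.slice 0 r₊)` — induced metric
  `h_static = ι^* g_static = δ + (2M/(r − 2M)) dr²` (`PseudoRiemannianMetric.inducedRiemannianMetric`,
  the construction of `Kerr.data`) and `k = 0`;
* `Schwarzschild.secondFundamentalForm_staticSliceEmbed` — **`K_N = 0`**: the slice is totally geodesic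
  (time symmetry, Wald §10.2), by the coordinate formula `K_N(v, w) = g(DN v + Γ(N)(ṽ), w̃)`
  (`OpensChart.secondFundamentalForm_eq_of_repr`) and the vanishing of the three Koszul terms:
  `g_static` does not depend on `t` (`fderiv_staticBilin_basisVector_zero`) and `g_static(∂_t, ·)`
  vanishes identically on tangential vectors (`fderiv_staticBilin_basisVector_zero_left/right`); the
  differentiability of the static components off `{r = 0} ∪ {r = 2M}` is `differentiableAt_staticBilin`;
* `Schwarzschild.staticMetric_isRicciFlat` — **`Ric(g_static) = 0`** for every real `M`: `g_static` is by
  construction the pull-back `(toKerrSchild M)^* g_KS` (`Schwarzschild.staticMetric` is a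
  `LorentzianMetric.comap`), the Ricci tensor is natural (`PseudoRiemannianMetric.ricci_comap_apply`,
  O'Neill Ch. 3, Prop. 3.59) and `Ric(g_KS) = 0` is the kernel theorem
  `Kerr.ricci_smoothMetric_zero_spin` (Kerr–Schild 1965, §3);
* `Schwarzschild.staticVacuumCauchyDevelopment M hM : VacuumCauchyDevelopment (staticSliceData M hM.le)`,
  `0 < M` — **the static exterior `(Kerr.exterior M 0, g_static, ∂_t)` with the slice `{t = 0}` and the
  normal `N` is a vacuum Cauchy development of the time-symmetric data** (Ringström Def. 16.2–16.3), with
  spacetime `Schwarzschild.staticSpacetime M : Spacetime 4` (defined for every real `M`), and the `rfl`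
  projections `staticVacuumCauchyDevelopment_toCauchyDevelopment_toSpacetime`, `dev_carrier`, `dev_metric`,
  `dev_timeOrientation`, `dev_embed`, `dev_normal`;
* § Development level — `Schwarzschild.dev_isQuasiFinalAnalytic`, `dev_hasUniformCollarControl`,
  `dev_isQuasiFinalAnalyticCollar`, `dev_hasADMForm`, `dev_isQuasiFinalTemporalChart`,
  `dev_isCauchyHypersurface_level_time`, `dev_labelLine_isFutureTimelikeCurveOn`: the manifold-level
  theorems of `SchwarzschildStaticLateChart` / `SchwarzschildStaticCauchyTime` read on
  `(𝒟₁.carrier, 𝒟₁.metric, 𝒟₁.timeOrientation)`, `𝒟₁ := (staticVacuumCauchyDevelopment M hM).toCauchyDevelopment`,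
  with the areal late chart `Schwarzschild.lateChart`, every `r₀ > 0`, `r₀ ≥ 4M`, `T̲`.

Conditionality and scope (honest label).  Everything is modulo the prelude's standing hypothesis classes
`[Kerr.Facts]` ∧ `[Kerr.SliceFacts]` exactly as `Kerr.data` / `Kerr.dataEmbedding_isVacuum` are; the
members actually used are `Kerr.Facts.isConnected_region` (connectedness of the carrier, through
`Kerr.connectedSpace_region`), `Kerr.Facts.contMDiff_bilin` (the Kerr–Schild metric, through
`Kerr.smoothMetric`, of which `g_static` is the pull-back), `Kerr.SliceFacts.isConnected_slice`
(`ConnectedSpace (Kerr.slice 0 r₊)`, demanded by `CauchyDevelopment`, through `Kerr.connectedSpace_slice`)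
and `Kerr.SliceFacts.isCovariantDerivativeOn_leviCivitaFun` (the Levi-Civita instance of `g_KS`, through
`Kerr.hasLeviCivita_smoothMetric`, in `staticMetric_isRicciFlat` only); no member is added, no class, no
named fact.  `0 < M` is load-bearing exactly in the Cauchy property (`isCauchyHypersurface_level_time`):
for `M ≤ 0` the chart is not globally hyperbolic and nothing is claimed (the slice data, the normal,
`K = 0` and `Ric = 0` are stated for `0 ≤ M` resp. every real `M`).  Maximality of the development
(`VacuumCauchyDevelopment.IsMaximal`: the exterior is the maximal Cauchy development of the exterior slice)
is NOT claimed.  The rotating case `a ≠ 0` is not addressed.  A Literature inhabitant of a typed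
hypothesis class proves nothing about any summit.

## References

* [ONeillSemiRiemannian1983] B. O'Neill, *Semi-Riemannian geometry*, Academic Press 1983, Ch. 3,
  Prop. 3.59; Ch. 13, Def. 13.2, "Schwarzschild observers"; Ch. 14, Def. 14.28 (p. 415), Exercise 14.6.
* [Wald1984] R. M. Wald, *General Relativity*, Chicago 1984, §6.1, §10.2.
* [Ringstrom2009] H. Ringström, *The Cauchy Problem in General Relativity*, EMS 2009, Def. 16.2–16.3.
* [GriffithsPodolsky2009] J. B. Griffiths, J. Podolský, *Exact space-times*, CUP 2009, §8.1, (8.1).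
* [KerrSchild1965] R. P. Kerr, A. Schild (1965), §3.
* [Ellithy2026] A. Ellithy, arXiv:2605.18730 (2026), §4.1 (p. 38), Def. 4.4 (p. 39), Rem. 4.6 (p. 40).
-/

noncomputable section

-- instance search through the nested operator types `E4 →L E4 →L E4 →L ℝ` (as in `ChartCurvature`)
set_option maxSynthPendingDepth 3

open Bundle TopologicalSpace Manifold Set Module Filter Function
open scoped ContDiff Topology InnerProductSpace Manifold

namespace Literature.Geometry.Lorentzian

namespace Schwarzschild

variable {M : ℝ}

/-! ### The time-symmetric slice `{t = 0}` of the static chart and its embedding -/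

/-- Points of the slice `Kerr.slice 0 r₊` (`r₊ = r₊(M, 0) ≥ 2M`) have `‖y‖ > 2M`: the slice lies in the
exterior `r > 2m` of Griffiths–Podolský 2009, §8.1. [cite: GriffithsPodolsky2009, §8.1 (8.1)] -/
theorem two_mul_lt_norm_of_slice_rPlus (y : Kerr.slice 0 (Kerr.rPlus M 0)) : 2 * M < ‖(y : E3)‖ :=
  ((two_mul_le_rPlus_zero M).trans (le_max_left _ _)).trans_lt (Kerr.mem_slice_zero_iff.1 y.2)

/-- On the slice `1 - 2M/‖y‖ > 0` (the lapse² of the static chart is positive on the exterior).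
[cite: GriffithsPodolsky2009, §8.1 (8.1)] -/
theorem one_sub_pos_of_slice (y : Kerr.slice 0 (Kerr.rPlus M 0)) : 0 < 1 - 2 * M / ‖(y : E3)‖ := by
  rw [sub_pos, div_lt_one (Kerr.norm_pos_of_mem_slice_zero y)]
  exact two_mul_lt_norm_of_slice_rPlus y

variable (M) in
/-- **The embedding of the time-symmetric slice into the static chart**, `y ↦ (0, y)`: the prelude's
Kerr–Schild slice embedding `Kerr.sliceEmbed 0 r₊` (`{t* = 0}` and `{t = 0}` are the same coordinate
hyperplane of `E4`; only the metric read on the chart differs), with the carrier spelled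
`Kerr.exterior M 0 = Kerr.region 0 r₊` as the static metric `Schwarzschild.staticMetric M` demands.
O'Neill 1983, Ch. 13, Def. 13.2 (the exterior `N`, `r > 2M`, and its slices `t = const`).
[cite: ONeillSemiRiemannian1983, Ch. 13, Def. 13.2] -/
def staticSliceEmbed : Kerr.slice 0 (Kerr.rPlus M 0) → Kerr.exterior M 0 :=
  Kerr.sliceEmbed 0 (Kerr.rPlus M 0)

/-- `staticSliceEmbed` IS `Kerr.sliceEmbed 0 r₊` (by `rfl`). [cite: ONeillSemiRiemannian1983, Ch. 13, Def. 13.2] -/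
theorem staticSliceEmbed_eq : staticSliceEmbed M = Kerr.sliceEmbed 0 (Kerr.rPlus M 0) := rfl

/-- Unfolding lemma: `staticSliceEmbed M y = (0, y)` in `E4`. [cite: ONeillSemiRiemannian1983, Ch. 13, Def. 13.2] -/
@[simp]
theorem coe_staticSliceEmbed (y : Kerr.slice 0 (Kerr.rPlus M 0)) :
    (staticSliceEmbed M y : E4) = E4.ofTimeSpace 0 (y : E3) := rfl

/-- The differential of the slice embedding is `v ↦ (0, v)` (`Kerr.mfderiv_sliceEmbed_apply`).
[cite: ONeillSemiRiemannian1983, Ch. 13, Def. 13.2] -/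
theorem mfderiv_staticSliceEmbed_apply (y : Kerr.slice 0 (Kerr.rPlus M 0)) (v : E3) :
    mfderiv 𝓘(ℝ, E3) 𝓘(ℝ, E4) (staticSliceEmbed M) y v = E4.ofTimeSpace 0 v :=
  Kerr.mfderiv_sliceEmbed_apply 0 _ y v

/-- The slice embedding is `C^n` for every `n` (`Kerr.contMDiff_sliceEmbed`).
[cite: ONeillSemiRiemannian1983, Ch. 13, Def. 13.2] -/
theorem contMDiff_staticSliceEmbed (n : ℕ∞ω) : ContMDiff 𝓘(ℝ, E3) 𝓘(ℝ, E4) n (staticSliceEmbed M) :=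
  Kerr.contMDiff_sliceEmbed 0 _ n

/-- **The slice embedding is a smooth embedding** (immersion + homeomorphism onto its image): the
prelude's discharged fact `Kerr.isSmoothEmbedding_sliceEmbed_holds` (metric-free). Hawking–Ellis 1973,
§2.3; Lee, *Introduction to Smooth Manifolds*, Thm. 4.12. [cite: HawkingEllis1973, §2.3] -/
theorem isSmoothEmbedding_staticSliceEmbed :
    Manifold.IsSmoothEmbedding 𝓘(ℝ, E3) 𝓘(ℝ, E4) ∞ (staticSliceEmbed M) :=
  Kerr.isSmoothEmbedding_sliceEmbed_holds 0 _

/-- **The image of the slice embedding is the level `{t = 0}` of static time** on the chart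
`Kerr.exterior M 0` (every point `x` of the chart with `x⁰ = 0` is `(0, x⃗)` with `x⃗` in the slice).
O'Neill 1983, Ch. 13, Def. 13.2. [cite: ONeillSemiRiemannian1983, Ch. 13, Def. 13.2] -/
theorem range_staticSliceEmbed :
    range (staticSliceEmbed M) = (fun x : Kerr.exterior M 0 ↦ E4.time (x : E4)) ⁻¹' {0} := by
  ext x
  constructor
  · rintro ⟨y, rfl⟩
    exact E4.time_ofTimeSpace 0 (y : E3)
  · intro hx
    have hx0 : E4.time (x : E4) = 0 := hx
    have hpt : E4.ofTimeSpace 0 (E4.spatial (x : E4)) = (x : E4) := by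
      have h := E4.ofTimeSpace_time_spatial (x : E4)
      rw [hx0] at h
      exact h
    have hmem : E4.spatial (x : E4) ∈ Kerr.slice 0 (Kerr.rPlus M 0) := by
      rw [Kerr.mem_slice_iff_ofTimeSpace_mem_region, hpt]
      exact x.2
    exact ⟨⟨E4.spatial (x : E4), hmem⟩, Subtype.ext hpt⟩

/-- **The time-symmetric slice is a Cauchy hypersurface of the static chart**, `0 < M`: its image is
the level `{t = 0}`, a Cauchy hypersurface of `(Kerr.exterior M 0, g_static, ∂_t)` by
`Schwarzschild.isCauchyHypersurface_level_time` (O'Neill 1983, Def. 14.28 and Exercise 14.6: the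
Schwarzschild exterior `N` is globally hyperbolic). For `M ≤ 0` this is false (the chart is then not
globally hyperbolic) and is not claimed. [cite: ONeillSemiRiemannian1983, Ch. 14, Def. 14.28 (p. 415), Exercise 6] -/
theorem isCauchyHypersurface_range_staticSliceEmbed [Kerr.Facts] (hM : 0 < M) :
    (staticMetric M).IsCauchyHypersurface (staticTimeOrientation M) (range (staticSliceEmbed M)) := by
  rw [range_staticSliceEmbed]
  exact isCauchyHypersurface_level_time hM 0

/-! ### The future unit normal `N = (1 − 2M/r)^{-1/2} ∂_t` of the slice -/

variable (M) in
/-- **The future unit normal of the time-symmetric slice `{t = 0}` of the static chart**: the normalised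
static Killing field `N(y) = (1 − 2M/‖y‖)^{-1/2} ∂_t` along `y ↦ (0, y)` (the same field of values as
`Kerr.staticNormalRep` of `SchwarzschildStaticLeaf`, the static leaf read in the Kerr–Schild chart).
Wald 1984, §6.1 (static observers) and §10.2 (the unit normal of a time-symmetric slice); O'Neill 1983,
Ch. 13, "Schwarzschild observers". [cite: Wald1984, §10.2] -/
def staticSliceNormal : NormalField 𝓘(ℝ, E4) (staticSliceEmbed M) :=
  fun y ↦ (√(1 - 2 * M / ‖(y : E3)‖))⁻¹ • E4.basisVector 0

/-- Unfolding lemma: `N(y) = (1 − 2M/‖y‖)^{-1/2} ∂_t`. [cite: Wald1984, §10.2] -/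
theorem staticSliceNormal_apply (y : Kerr.slice 0 (Kerr.rPlus M 0)) :
    staticSliceNormal M y = (√(1 - 2 * M / ‖(y : E3)‖))⁻¹ • E4.basisVector 0 := rfl

/-- `g_static(N, N) = -1` on the slice (`g_static(∂_t, ∂_t) = -(1 - 2M/r)`). [cite: Wald1984, §10.2] -/
theorem staticBilin_staticSliceNormal_self (y : Kerr.slice 0 (Kerr.rPlus M 0)) :
    staticBilin M (E4.ofTimeSpace 0 (y : E3)) (staticSliceNormal M y) (staticSliceNormal M y) = -1 := by
  have hq := one_sub_pos_of_slice y
  rw [staticSliceNormal_apply, map_smul, map_smul, smul_apply, smul_eq_mul, smul_eq_mul,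
    staticBilin_basisVector_zero_zero, E4.spatialNorm_ofTimeSpace]
  have hs : (√(1 - 2 * M / ‖(y : E3)‖))⁻¹ * (√(1 - 2 * M / ‖(y : E3)‖))⁻¹ = (1 - 2 * M / ‖(y : E3)‖)⁻¹ := by
    rw [← mul_inv, Real.mul_self_sqrt hq.le]
  calc (√(1 - 2 * M / ‖(y : E3)‖))⁻¹ * ((√(1 - 2 * M / ‖(y : E3)‖))⁻¹ * -(1 - 2 * M / ‖(y : E3)‖))
      = -((√(1 - 2 * M / ‖(y : E3)‖))⁻¹ * (√(1 - 2 * M / ‖(y : E3)‖))⁻¹ * (1 - 2 * M / ‖(y : E3)‖)) := by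
        ring
    _ = -1 := by rw [hs, inv_mul_cancel₀ hq.ne']

/-- `g_static(N, (0, w)) = 0`: `N ∥ ∂_t` is orthogonal to the slice. [cite: Wald1984, §10.2] -/
theorem staticBilin_staticSliceNormal_ofTimeSpace (y : Kerr.slice 0 (Kerr.rPlus M 0)) (w : E3) :
    staticBilin M (E4.ofTimeSpace 0 (y : E3)) (staticSliceNormal M y) (E4.ofTimeSpace 0 w) = 0 := by
  rw [staticSliceNormal_apply, map_smul, smul_apply, smul_eq_mul, staticBilin_basisVector_zero_left,
    E4.ofTimeSpace_apply_zero, mul_zero, neg_zero, mul_zero]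

/-- `g_static(∂_t, N) = -(1 - 2M/r)^{1/2} < 0`: `N` is future-directed for the orientation `∂_t`.
[cite: ONeillSemiRiemannian1983, Ch. 13, Schwarzschild observers] -/
theorem staticBilin_basisVector_zero_staticSliceNormal_neg (y : Kerr.slice 0 (Kerr.rPlus M 0)) :
    staticBilin M (E4.ofTimeSpace 0 (y : E3)) (E4.basisVector 0) (staticSliceNormal M y) < 0 := by
  have hq := one_sub_pos_of_slice y
  rw [staticSliceNormal_apply, map_smul, smul_eq_mul, staticBilin_basisVector_zero_zero,
    E4.spatialNorm_ofTimeSpace]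
  have h1 : 0 < (√(1 - 2 * M / ‖(y : E3)‖))⁻¹ := inv_pos.2 (Real.sqrt_pos.2 hq)
  nlinarith

/-- **`N` is the future unit normal of the time-symmetric slice** in the time-oriented static chart
`(Kerr.exterior M 0, g_static, ∂_t)`: `g(N, d(staticSliceEmbed) v) = 0`, `g(N, N) = -1`,
`g(∂_t, N) < 0` (every real `M`). Wald 1984, §10.2; O'Neill 1983, Ch. 13. [cite: Wald1984, §10.2] -/
theorem isFutureUnitNormal_staticSliceNormal [Kerr.Facts] :
    (staticMetric M).IsFutureUnitNormal 𝓘(ℝ, E3) (staticTimeOrientation M)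
      (staticSliceEmbed M) (staticSliceNormal M) := by
  have hunit : ∀ y : Kerr.slice 0 (Kerr.rPlus M 0),
      (staticMetric M).val (staticSliceEmbed M y) (staticSliceNormal M y) (staticSliceNormal M y) = -1 :=
    fun y ↦ by
      rw [staticMetric_val, coe_staticSliceEmbed]
      exact staticBilin_staticSliceNormal_self y
  refine ⟨⟨fun y v ↦ ?_, hunit⟩, fun y ↦ ⟨?_, ?_⟩⟩
  · rw [mfderiv_staticSliceEmbed_apply, staticMetric_val, coe_staticSliceEmbed]
    exact staticBilin_staticSliceNormal_ofTimeSpace y v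
  · have ht : (staticMetric M).IsTimelike (staticSliceNormal M y) := by
      rw [LorentzianMetric.isTimelike_iff, hunit y]
      norm_num
    exact ht.isCausal
  · rw [staticTimeOrientation_vectorField, staticMetric_val, coe_staticSliceEmbed]
    exact staticBilin_basisVector_zero_staticSliceNormal_neg y

/-- `N` is differentiable (as a function on `E3`) at the points of the slice (the lapse
`(1 − 2M/r)^{1/2}` of the static observers is smooth and positive on the exterior). [cite: Wald1984, §6.1] -/
theorem differentiableAt_staticSliceNormalRep (M : ℝ) {y : E3} (hy : 2 * M < ‖y‖) (hy0 : y ≠ 0) :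
    DifferentiableAt ℝ (fun y : E3 ↦ (√(1 - 2 * M / ‖y‖))⁻¹ • E4.basisVector 0) y := by
  have hq : 0 < 1 - 2 * M / ‖y‖ := by
    rw [sub_pos, div_lt_one (norm_pos_iff.2 hy0)]; exact hy
  have hn : ContDiffAt ℝ 1 (fun y : E3 ↦ ‖y‖) y := contDiffAt_norm ℝ hy0
  have h1 : ContDiffAt ℝ 1 (fun y : E3 ↦ 1 - 2 * M / ‖y‖) y :=
    contDiffAt_const.sub ((contDiffAt_const.div hn (norm_ne_zero_iff.2 hy0)))
  have h2 : ContDiffAt ℝ 1 (fun y : E3 ↦ (√(1 - 2 * M / ‖y‖))⁻¹) y :=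
    (h1.sqrt hq.ne').inv (Real.sqrt_pos.2 hq).ne'
  exact (h2.smul contDiffAt_const).differentiableAt one_ne_zero

/-- The derivative of `N = f ∂_t` is `(df v) ∂_t`: it is proportional to `∂_t`. [cite: Wald1984, §6.1] -/
theorem fderiv_staticSliceNormalRep (M : ℝ) {y : E3} (hy : 2 * M < ‖y‖) (hy0 : y ≠ 0) (v : E3) :
    fderiv ℝ (fun y : E3 ↦ (√(1 - 2 * M / ‖y‖))⁻¹ • E4.basisVector 0) y v =
      fderiv ℝ (fun y : E3 ↦ (√(1 - 2 * M / ‖y‖))⁻¹) y v • E4.basisVector 0 := by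
  have hq : 0 < 1 - 2 * M / ‖y‖ := by
    rw [sub_pos, div_lt_one (norm_pos_iff.2 hy0)]; exact hy
  have hn : ContDiffAt ℝ 1 (fun y : E3 ↦ ‖y‖) y := contDiffAt_norm ℝ hy0
  have h1 : ContDiffAt ℝ 1 (fun y : E3 ↦ 1 - 2 * M / ‖y‖) y :=
    contDiffAt_const.sub ((contDiffAt_const.div hn (norm_ne_zero_iff.2 hy0)))
  have h2 : DifferentiableAt ℝ (fun y : E3 ↦ (√(1 - 2 * M / ‖y‖))⁻¹) y :=
    ((h1.sqrt hq.ne').inv (Real.sqrt_pos.2 hq).ne').differentiableAt one_ne_zero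
  rw [fderiv_smul_const h2]
  simp

/-! ### The slice is spacelike; the time-symmetric data `(h_static, 0)` -/

/-- **The slice `{t = 0}` is spacelike for `g_static`** (`0 ≤ M`): on tangent vectors `(0, v)`,
`g_static((0,v), (0,v)) = ‖v‖² + (2M/(r − 2M)) (⟪y, v⟫/r)² > 0` for `v ≠ 0`. Griffiths–Podolský 2009,
(8.1); Wald 1984, §10.2. [cite: GriffithsPodolsky2009, §8.1 (8.1)] -/
theorem isSpacelikeImmersion_staticSliceEmbed [Kerr.Facts] (hM : 0 ≤ M) :
    (staticMetric M).IsSpacelikeImmersion 𝓘(ℝ, E3) (staticSliceEmbed M) := by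
  refine ⟨contMDiff_staticSliceEmbed _, fun y v hv ↦ ?_⟩
  have hy := two_mul_lt_norm_of_slice_rPlus y
  set w : E3 := v with hw
  have hw0 : w ≠ 0 := hv
  have hgoal : 0 < staticBilin M (E4.ofTimeSpace 0 (y : E3)) (E4.ofTimeSpace 0 w) (E4.ofTimeSpace 0 w) := by
    rw [staticBilin_apply, E4.ofTimeSpace_apply_zero, mul_zero, mul_zero, neg_zero, zero_add,
      E4.spatialNorm_ofTimeSpace]
    have h1 : sdot (E4.ofTimeSpace 0 w) (E4.ofTimeSpace 0 w) = ‖w‖ ^ 2 := by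
      rw [sdot, E4.spatial_ofTimeSpace, real_inner_self_eq_norm_sq]
    have h2 : 0 ≤ 2 * M / (‖(y : E3)‖ - 2 * M) * (nu (E4.ofTimeSpace 0 (y : E3)) (E4.ofTimeSpace 0 w) *
        nu (E4.ofTimeSpace 0 (y : E3)) (E4.ofTimeSpace 0 w)) :=
      mul_nonneg (div_nonneg (by linarith) (sub_pos.2 hy).le) (mul_self_nonneg _)
    have h3 : 0 < ‖w‖ ^ 2 := by positivity
    rw [h1]
    linarith
  rw [PseudoRiemannianMetric.inducedBilin_apply, mfderiv_staticSliceEmbed_apply, staticMetric_val,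
    coe_staticSliceEmbed]
  exact hgoal

variable (M) in
/-- **The time-symmetric Schwarzschild data** `(Kerr.slice 0 r₊, h_static, 0)`: the slice `{t = 0}`,
`‖y‖ > 2M`, of the static chart with the INDUCED Riemannian metric
`h_static = (staticSliceEmbed)^* g_static = δ + (2M/(r − 2M)) dr²` (`= (1 − 2M/r)⁻¹ dr² + r² dΩ²`, the
`t = const` metric of Griffiths–Podolský 2009, (8.1); `PseudoRiemannianMetric.inducedRiemannianMetric`,
smoothness of pull-backs `contMDiff_pullbackBilin_holds`, the construction of `Kerr.data`) and the ZERO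
second fundamental form (time symmetry; that this IS the second fundamental form of the slice is
`secondFundamentalForm_staticSliceEmbed`). Wald 1984, §10.2 ("time symmetric initial data …
`K_{ab} = 0`"); O'Neill 1983, Ch. 13, Def. 13.2. The binder `0 ≤ M` makes the slice spacelike.
[cite: Wald1984, §10.2] -/
def staticSliceData [Kerr.Facts] (hM : 0 ≤ M) :
    InitialDataSet 𝓘(ℝ, E3) (Kerr.slice 0 (Kerr.rPlus M 0)) where
  h := (staticMetric M).inducedRiemannianMetric (staticSliceEmbed M)
    PseudoRiemannianMetric.contMDiff_pullbackBilin_holds (isSpacelikeImmersion_staticSliceEmbed hM)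
  k _ := 0
  k_symm _ _ _ := rfl
  contMDiff_k := contMDiff_zero_bilinSection

/-- The metric of the time-symmetric data is the induced form `g_static((0,v), (0,w))` at `(0, y)`.
[cite: GriffithsPodolsky2009, §8.1 (8.1)] -/
@[simp]
theorem staticSliceData_h_inner [Kerr.Facts] (hM : 0 ≤ M) (y : Kerr.slice 0 (Kerr.rPlus M 0)) :
    (staticSliceData M hM).h.inner y =
      (staticMetric M).inducedBilin 𝓘(ℝ, E3) (staticSliceEmbed M) y :=
  rfl

/-- The tensor `k` of the time-symmetric data vanishes. [cite: Wald1984, §10.2] -/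
@[simp]
theorem staticSliceData_k [Kerr.Facts] (hM : 0 ≤ M) (y : Kerr.slice 0 (Kerr.rPlus M 0)) :
    (staticSliceData M hM).k y = 0 := rfl

/-- … and so does its algebraic bilinear form. [cite: Wald1984, §10.2] -/
@[simp]
theorem staticSliceData_kBilin [Kerr.Facts] (hM : 0 ≤ M) (y : Kerr.slice 0 (Kerr.rPlus M 0)) :
    (staticSliceData M hM).kBilin y = 0 := by
  ext v w
  simp [InitialDataSet.kBilin_apply]

/-! ### Calculus of the static components: differentiability, stationarity, hypersurface-orthogonality -/

/-- `x ↦ ⟪x⃗, ·⟫` is differentiable (it is the continuous linear map `Kerr.covecSpatial ∘ spatial`).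
[folklore] -/
private theorem differentiable_sdotCLM : Differentiable ℝ (sdotCLM : E4 → E4 →L[ℝ] ℝ) := by
  have h : (sdotCLM : E4 → E4 →L[ℝ] ℝ) = fun x ↦ (Kerr.covecSpatial.comp E4.spatial) x := by
    funext x
    rw [ContinuousLinearMap.comp_apply, Kerr.covecSpatial_eq]
    rfl
  rw [h]
  exact (Kerr.covecSpatial.comp E4.spatial).differentiable

/-- **The static components are differentiable off `{r = 0} ∪ {r = 2M}`** (rational functions of `r`
times constant resp. bilinear covector fields). Griffiths–Podolský 2009, (8.1). [cite: GriffithsPodolsky2009, §8.1 (8.1)] -/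
theorem differentiableAt_staticBilin {x : E4} (hx : E4.spatial x ≠ 0)
    (h2 : E4.spatialNorm x - 2 * M ≠ 0) : DifferentiableAt ℝ (staticBilin M) x := by
  have hr : E4.spatialNorm x ≠ 0 := by
    rw [E4.spatialNorm]; exact norm_ne_zero_iff.2 hx
  have hn : ContDiffAt ℝ 1 E4.spatialNorm x := (contDiffAt_norm ℝ hx).comp x E4.spatial.contDiff.contDiffAt
  have hc1' : ContDiffAt ℝ 1 (fun x ↦ 2 * M / E4.spatialNorm x) x := contDiffAt_const.div hn hr
  have hc2' : ContDiffAt ℝ 1 (fun x ↦ 2 * M / ((E4.spatialNorm x - 2 * M) * E4.spatialNorm x ^ 2)) x :=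
    contDiffAt_const.div ((hn.sub contDiffAt_const).mul (hn.pow 2)) (mul_ne_zero h2 (pow_ne_zero 2 hr))
  have hc1 := hc1'.differentiableAt one_ne_zero
  have hc2 := hc2'.differentiableAt one_ne_zero
  have ht : DifferentiableAt ℝ (fun x ↦ E4.tmul (sdotCLM x) (sdotCLM x)) x := by
    have hb := (ContinuousLinearMap.smulRightL ℝ E4 (E4 →L[ℝ] ℝ)).isBoundedBilinearMap
    have h2' : DifferentiableAt ℝ (fun x : E4 ↦ (sdotCLM x, sdotCLM x)) x :=
      (differentiable_sdotCLM x).prodMk (differentiable_sdotCLM x)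
    exact (hb.differentiableAt (sdotCLM x, sdotCLM x)).comp x h2'
  have hfun : staticBilin M = fun x ↦ Minkowski.bilin + (2 * M / E4.spatialNorm x) • E4.tmul (E4.dx 0) (E4.dx 0) +
      (2 * M / ((E4.spatialNorm x - 2 * M) * E4.spatialNorm x ^ 2)) • E4.tmul (sdotCLM x) (sdotCLM x) := rfl
  rw [hfun]
  exact ((differentiableAt_const _).add (hc1.smul (differentiableAt_const _))).add (hc2.smul ht)

/-- **Stationarity**: the static components do not depend on `t`, `g_static(x + s ∂_t) = g_static(x)`.
[cite: GriffithsPodolsky2009, §8.1 (8.1)] -/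
theorem staticBilin_add_smul_basisVector (x : E4) (s : ℝ) :
    staticBilin M (x + s • E4.basisVector 0) = staticBilin M x := by
  have hsp : E4.spatial (x + s • E4.basisVector 0) = E4.spatial x := by
    rw [map_add, map_smul, Kerr.spatial_basisVector_zero, smul_zero, add_zero]
  have hn : E4.spatialNorm (x + s • E4.basisVector 0) = E4.spatialNorm x := by
    rw [E4.spatialNorm, E4.spatialNorm, hsp]
  have hs : sdotCLM (x + s • E4.basisVector 0) = sdotCLM x := by
    rw [sdotCLM, sdotCLM, hsp]
  rw [staticBilin, staticBilin, hn, hs]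

/-- `(∂_{∂_t} g_static) = 0` wherever `g_static` is differentiable: the static Killing field in its own
chart. [cite: GriffithsPodolsky2009, §8.1 (8.1)] -/
theorem fderiv_staticBilin_basisVector_zero {x : E4} (hd : DifferentiableAt ℝ (staticBilin M) x) :
    fderiv ℝ (staticBilin M) x (E4.basisVector 0) = 0 := by
  -- differentiate along the line `s ↦ x + s ∂_t`, on which `g_static` is constant
  have hl : HasDerivAt (fun s : ℝ ↦ x + s • E4.basisVector 0) (E4.basisVector 0) 0 := by
    have h := ((hasDerivAt_id (0 : ℝ)).smul_const (E4.basisVector 0)).const_add x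
    rwa [one_smul] at h
  have h1 : HasDerivAt (fun s : ℝ ↦ staticBilin M (x + s • E4.basisVector 0))
      (fderiv ℝ (staticBilin M) x (E4.basisVector 0)) 0 := by
    have hd' : HasFDerivAt (staticBilin M) (fderiv ℝ (staticBilin M) x) (x + (0 : ℝ) • E4.basisVector 0) := by
      rw [zero_smul, add_zero]; exact hd.hasFDerivAt
    exact hd'.comp_hasDerivAt (0 : ℝ) hl
  have h2 : HasDerivAt (fun s : ℝ ↦ staticBilin M (x + s • E4.basisVector 0)) 0 0 := by
    have hc : (fun s : ℝ ↦ staticBilin M (x + s • E4.basisVector 0)) = fun _ ↦ staticBilin M x :=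
      funext fun s ↦ staticBilin_add_smul_basisVector x s
    rw [hc]
    exact hasDerivAt_const 0 _
  exact h1.unique h2

/-- **Hypersurface-orthogonality, differentiated**: `(∂_U g_static)(∂_t, W) = 0` for tangential `W`
(`W⁰ = 0`), since `g_static(∂_t, W) = -(1 - 2M/r) W⁰ ≡ 0`. [cite: GriffithsPodolsky2009, §8.1 (8.1)] -/
theorem fderiv_staticBilin_basisVector_zero_left {x : E4} (hd : DifferentiableAt ℝ (staticBilin M) x)
    (U W : E4) (hW : W 0 = 0) :
    fderiv ℝ (staticBilin M) x U (E4.basisVector 0) W = 0 := by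
  rw [← OpensChart.fderiv_apply₂ (staticBilin M) hd (E4.basisVector 0) W U]
  have hc : (fun y ↦ staticBilin M y (E4.basisVector 0) W) = fun _ ↦ (0 : ℝ) := by
    funext y
    rw [staticBilin_basisVector_zero_left, hW, mul_zero, neg_zero]
  rw [hc, fderiv_const_apply, zero_apply]

/-- The same with the slots exchanged (`g_static` is symmetric). [cite: GriffithsPodolsky2009, §8.1 (8.1)] -/
theorem fderiv_staticBilin_basisVector_zero_right {x : E4} (hd : DifferentiableAt ℝ (staticBilin M) x)
    (U V : E4) (hV : V 0 = 0) :
    fderiv ℝ (staticBilin M) x U V (E4.basisVector 0) = 0 := by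
  rw [← OpensChart.fderiv_apply₂ (staticBilin M) hd V (E4.basisVector 0) U]
  have hc : (fun y ↦ staticBilin M y V (E4.basisVector 0)) = fun _ ↦ (0 : ℝ) := by
    funext y
    rw [staticBilin_symm, staticBilin_basisVector_zero_left, hV, mul_zero, neg_zero]
  rw [hc, fderiv_const_apply, zero_apply]

/-! ### Time symmetry: the slice is totally geodesic, `K_N = 0` -/

/-- **The time-symmetric slice is totally geodesic: `K_N = 0`.** The second fundamental form of
`staticSliceEmbed M` w.r.t. its future unit normal `N` vanishes identically (every real `M`, every
Levi-Civita instance of `g_static`): in the coordinate formula `K_N(v, w) = g(DN v + Γ(N)(ṽ), w̃)`,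
`ṽ = (0, v)` (`OpensChart.secondFundamentalForm_eq_of_repr`), the first term vanishes because
`DN v ∥ ∂_t ⊥ w̃`, and `2 g(Γ(N)(ṽ), w̃) = (∂_ṽ g)(N, w̃) + (∂_N g)(w̃, ṽ) − (∂_w̃ g)(ṽ, N)` vanishes term
by term: `g_static(∂_t, ·) ≡ 0` on tangential vectors (first and third) and `∂_{∂_t} g_static = 0`
(middle). This is the time symmetry of the static slices of Schwarzschild. Wald 1984, §10.2
(time-symmetric initial data, `K_{ab} = 0`); O'Neill 1983, Ch. 4, Lemma 4.4 ff. [cite: Wald1984, §10.2] -/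
theorem secondFundamentalForm_staticSliceEmbed [Kerr.Facts]
    [(staticMetric M).toPseudoRiemannianMetric.HasLeviCivita] (y : Kerr.slice 0 (Kerr.rPlus M 0))
    (v w : E3) :
    (staticMetric M).toPseudoRiemannianMetric.secondFundamentalForm 𝓘(ℝ, E3) (staticSliceEmbed M)
      (staticSliceNormal M) y v w = 0 := by
  have hy : 2 * M < ‖(y : E3)‖ := two_mul_lt_norm_of_slice_rPlus y
  have hy0 : (y : E3) ≠ 0 := Kerr.ne_zero_of_mem_slice_zero y
  have hsp : E4.spatial (E4.ofTimeSpace 0 (y : E3)) ≠ 0 := by rwa [E4.spatial_ofTimeSpace]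
  have h2M : E4.spatialNorm (E4.ofTimeSpace 0 (y : E3)) - 2 * M ≠ 0 := by
    rw [E4.spatialNorm_ofTimeSpace]; exact (sub_pos.2 hy).ne'
  have hGd' : DifferentiableAt ℝ (staticBilin M) (E4.ofTimeSpace 0 (y : E3)) :=
    differentiableAt_staticBilin hsp h2M
  have hGd : DifferentiableAt ℝ (staticBilin M) (staticSliceEmbed M y : E4) := by
    rw [coe_staticSliceEmbed]; exact hGd'
  -- notation: the normal as a function on `E3`
  set N : E3 → E4 := fun y ↦ (√(1 - 2 * M / ‖y‖))⁻¹ • E4.basisVector 0 with hN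
  have hNy : N y = (√(1 - 2 * M / ‖(y : E3)‖))⁻¹ • E4.basisVector 0 := rfl
  -- the three vanishing first derivatives at `x = (0, y)`
  have h1 : fderiv ℝ (staticBilin M) (E4.ofTimeSpace 0 (y : E3)) (E4.ofTimeSpace 0 v) (E4.basisVector 0)
      (E4.ofTimeSpace 0 w) = 0 :=
    fderiv_staticBilin_basisVector_zero_left hGd' _ _ (E4.ofTimeSpace_apply_zero 0 w)
  have h2 : fderiv ℝ (staticBilin M) (E4.ofTimeSpace 0 (y : E3)) (E4.basisVector 0) = 0 :=
    fderiv_staticBilin_basisVector_zero hGd'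
  have h3 : fderiv ℝ (staticBilin M) (E4.ofTimeSpace 0 (y : E3)) (E4.ofTimeSpace 0 w) (E4.ofTimeSpace 0 v)
      (E4.basisVector 0) = 0 :=
    fderiv_staticBilin_basisVector_zero_right hGd' _ _ (E4.ofTimeSpace_apply_zero 0 v)
  -- the Christoffel symbols of the first kind: `g(Γ(N)(Ṽ), W̃) = ½ K(N, Ṽ, W̃)`
  have hΓ : staticBilin M (E4.ofTimeSpace 0 (y : E3))
      (OpensChart.christoffel (staticMetric M).toPseudoRiemannianMetric (staticBilin M) (staticSliceEmbed M y)
        (N y) (E4.ofTimeSpace 0 v)) (E4.ofTimeSpace 0 w) =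
      2⁻¹ * OpensChart.koszulForm (staticBilin M) (E4.ofTimeSpace 0 (y : E3)) (N y) (E4.ofTimeSpace 0 v)
        (E4.ofTimeSpace 0 w) := by
    have h := OpensChart.val_christoffel_const (g := (staticMetric M).toPseudoRiemannianMetric)
      (G := staticBilin M) (staticSliceEmbed M y) (N y) (E4.ofTimeSpace 0 v) (E4.ofTimeSpace 0 w)
    rw [staticMetric_val, coe_staticSliceEmbed] at h
    exact h
  rw [OpensChart.secondFundamentalForm_eq_of_repr (g := (staticMetric M).toPseudoRiemannianMetric)
    (G := staticBilin M) staticMetric_val (f := staticSliceEmbed M) (Φ := E4.ofTimeSpace 0)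
    coe_staticSliceEmbed (ν := staticSliceNormal M) (N := N) (fun _ ↦ rfl)
    (Kerr.hasFDerivAt_ofTimeSpace_zero _).differentiableAt (differentiableAt_staticSliceNormalRep M hy hy0)
    hGd v w, Kerr.fderiv_ofTimeSpace_zero, Kerr.fderiv_ofTimeSpace_zero, staticMetric_val, coe_staticSliceEmbed]
  show staticBilin M (E4.ofTimeSpace 0 (y : E3)) (fderiv ℝ N y v +
      OpensChart.christoffel (staticMetric M).toPseudoRiemannianMetric (staticBilin M) (staticSliceEmbed M y)
        (N y) (E4.ofTimeSpace 0 v)) (E4.ofTimeSpace 0 w) = 0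
  rw [map_add, add_apply, hΓ, hN, fderiv_staticSliceNormalRep M hy hy0 v, map_smul, smul_apply,
    staticBilin_basisVector_zero_left, E4.ofTimeSpace_apply_zero, mul_zero, neg_zero, smul_zero, zero_add,
    OpensChart.koszulForm_apply]
  simp only [map_smul, smul_apply, smul_eq_mul, h1, h2, h3, zero_apply, mul_zero, add_zero, sub_zero]

/-! ### The static metric is Ricci-flat -/

/-- **The static Schwarzschild metric is Ricci-flat**: `Ric(g_static) = 0` on `Kerr.exterior M 0`, for
every real `M` and every Levi-Civita instance of `g_static`. By construction `g_static` is the pull-back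
`(toKerrSchild M)^* g_KS` of the prelude's Kerr–Schild Schwarzschild metric `Kerr.smoothMetric M 0 r₊`
(`Schwarzschild.staticMetric` is literally a `LorentzianMetric.comap`), the Ricci tensor is natural under
local diffeomorphisms (`PseudoRiemannianMetric.ricci_comap_apply`, O'Neill 1983, Ch. 3, Prop. 3.59), and
`Ric(g_KS) = 0` is the kernel theorem `Kerr.ricci_smoothMetric_zero_spin` (Kerr–Schild 1965, §3;
O'Neill 1995, Thm. 2.6.1). The Levi-Civita instance of `g_KS` is the prelude's
`Kerr.hasLeviCivita_smoothMetric`, i.e. the member `isCovariantDerivativeOn_leviCivitaFun` of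
`[Kerr.SliceFacts]`; `[Kerr.Facts].contMDiff_bilin` carries the metric itself. Schwarzschild 1916;
Griffiths–Podolský 2009, §8.1. [cite: KerrSchild1965, §3] -/
theorem staticMetric_isRicciFlat [Kerr.Facts] [Kerr.SliceFacts]
    [inst : (staticMetric M).toPseudoRiemannianMetric.HasLeviCivita] :
    (staticMetric M).toPseudoRiemannianMetric.IsRicciFlat := by
  intro x
  refine LinearMap.ext fun v ↦ LinearMap.ext fun w ↦ ?_
  -- naturality of the Ricci tensor for the pull-back that DEFINES `staticMetric` (the Levi-Civita
  -- instance of the pull-back metric is `inst`, passed positionally)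
  have h := @PseudoRiemannianMetric.ricci_comap_apply _ _ _ _ _ _ _ _ _ _ _ _ _ _ _ _ _ _ _ _ _ _ _ _
      (Kerr.smoothMetric M 0 (Kerr.rPlus M 0)).toPseudoRiemannianMetric _
      PseudoRiemannianMetric.contMDiff_pullbackBilin_holds contMDiff_toKerrSchild_add_one
      mfderiv_toKerrSchild_injective rfl _ inst x v w
  rw [Kerr.ricci_smoothMetric_zero_spin] at h
  simp only [LinearMap.zero_apply] at h ⊢
  exact h

/-! ### The static exterior as a time-oriented spacetime and as a vacuum Cauchy development -/

variable (M) in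
/-- **The Schwarzschild exterior in static coordinates as a spacetime**: the open submanifold
`Kerr.exterior M 0 = {‖x⃗‖ > max(r₊, 0)}` of `E4` (connected: `Kerr.connectedSpace_region`, i.e.
`[Kerr.Facts].isConnected_region`) with the static metric `g_static` (`Schwarzschild.staticMetric`) and the
time orientation `∂_t` (`Schwarzschild.staticTimeOrientation`), bundled as a `Spacetime 4` — O'Neill's
Schwarzschild exterior `N`, time-oriented by the static Killing field (O'Neill 1983, Ch. 13, Def. 13.2 and
"Schwarzschild observers"); the static-chart counterpart of the prelude's Kerr–Schild
`Schwarzschild.exteriorSpacetime`. Defined for every real `M`.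
[cite: ONeillSemiRiemannian1983, Ch. 13, Def. 13.2] -/
def staticSpacetime [Kerr.Facts] : Spacetime 4 :=
  -- the chart's manifold instances are those of the open submanifold `Kerr.exterior M 0 ⊆ E4`, spelled
  -- out (`E4 = EuclideanSpace ℝ (Fin 4)` reducibly) so that the `Spacetime 4` signature elaborates
  { carrier := Kerr.exterior M 0
    topologicalSpace := inferInstance
    chartedSpace := inferInstanceAs (ChartedSpace E4 (Kerr.exterior M 0))
    isManifold := inferInstanceAs (IsManifold 𝓘(ℝ, E4) ∞ (Kerr.exterior M 0))
    t2Space := inferInstance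
    secondCountableTopology := inferInstance
    connectedSpace := Kerr.connectedSpace_region 0 (Kerr.rPlus M 0)
    metric := staticMetric M
    timeOrientation := staticTimeOrientation M }

/-- The carrier of the static spacetime is the chart `Kerr.exterior M 0` (by `rfl`).
[cite: ONeillSemiRiemannian1983, Ch. 13, Def. 13.2] -/
theorem staticSpacetime_carrier [Kerr.Facts] : (staticSpacetime M).carrier = Kerr.exterior M 0 := rfl

/-- The metric of the static spacetime is `g_static` (by `rfl`). [cite: GriffithsPodolsky2009, §8.1 (8.1)] -/
theorem staticSpacetime_metric [Kerr.Facts] : (staticSpacetime M).metric = staticMetric M := rfl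

/-- The time orientation of the static spacetime is `∂_t` (by `rfl`).
[cite: ONeillSemiRiemannian1983, Ch. 13, Schwarzschild observers] -/
theorem staticSpacetime_timeOrientation [Kerr.Facts] :
    (staticSpacetime M).timeOrientation = staticTimeOrientation M := rfl

/-! ### The static exterior as a vacuum Cauchy development of the time-symmetric data -/

variable (M) in
/-- **The positive-mass static Schwarzschild exterior is a vacuum Cauchy development of its
time-symmetric slice.** Spacetime: the open submanifold `Kerr.exterior M 0 = {‖x⃗‖ > 2M}` of `E4` with
the static metric `g_static` (`Schwarzschild.staticMetric`) and the time orientation `∂_t`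
(`Schwarzschild.staticTimeOrientation`; connected by `Kerr.connectedSpace_region`, i.e.
`[Kerr.Facts].isConnected_region`); data: `(Kerr.slice 0 r₊, h_static, 0)` (`staticSliceData`, connected
by `[Kerr.SliceFacts].isConnected_slice`); embedding `y ↦ (0, y)` (`staticSliceEmbed`, a smooth
embedding); future unit normal `N = (1 − 2M/r)^{-1/2} ∂_t` (`isFutureUnitNormal_staticSliceNormal`);
`ι^* g = h` by construction and `K_N = k = 0` (`secondFundamentalForm_staticSliceEmbed`); the image
`{t = 0}` is a Cauchy hypersurface (`isCauchyHypersurface_range_staticSliceEmbed`, **`0 < M`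
load-bearing**); `Ric(g_static) = 0` (`staticMetric_isRicciFlat`, through
`[Kerr.SliceFacts].isCovariantDerivativeOn_leviCivitaFun`). Maximality (that this is the MAXIMAL Cauchy
development of the exterior slice) is not claimed. O'Neill 1983, Ch. 13, Def. 13.2 and Ch. 14,
Exercise 14.6; Wald 1984, §10.2; Ringström 2009, Def. 16.2–16.3.
[cite: Ringstrom2009, Def. 16.3] -/
def staticVacuumCauchyDevelopment [Kerr.Facts] [Kerr.SliceFacts] (hM : 0 < M) :
    VacuumCauchyDevelopment (staticSliceData M hM.le) where
  toSpacetime := staticSpacetime M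
  embed := staticSliceEmbed M
  isSmoothEmbedding := isSmoothEmbedding_staticSliceEmbed
  normal := staticSliceNormal M
  isFutureUnitNormal := isFutureUnitNormal_staticSliceNormal
  induced_h := fun _ ↦ rfl
  induced_k := by
    intro inst y
    haveI : (staticMetric M).toPseudoRiemannianMetric.HasLeviCivita := inst
    rw [staticSliceData_kBilin]
    refine LinearMap.ext fun v ↦ LinearMap.ext fun w ↦ ?_
    rw [LinearMap.zero_apply, LinearMap.zero_apply]
    exact secondFundamentalForm_staticSliceEmbed y v w
  isCauchyHypersurface := isCauchyHypersurface_range_staticSliceEmbed hM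
  isRicciFlat := by
    intro inst
    haveI : (staticMetric M).toPseudoRiemannianMetric.HasLeviCivita := inst
    exact staticMetric_isRicciFlat

section Projections

variable [Kerr.Facts] [Kerr.SliceFacts] (hM : 0 < M)

/-- The carrier of the development is the static chart `Kerr.exterior M 0` (by `rfl`).
[cite: ONeillSemiRiemannian1983, Ch. 13, Def. 13.2] -/
theorem dev_carrier : (staticVacuumCauchyDevelopment M hM).carrier = Kerr.exterior M 0 := rfl

/-- The metric of the development is the static metric (by `rfl`). [cite: GriffithsPodolsky2009, §8.1 (8.1)] -/
theorem dev_metric : (staticVacuumCauchyDevelopment M hM).metric = staticMetric M := rfl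

/-- The time orientation of the development is `∂_t` (by `rfl`).
[cite: ONeillSemiRiemannian1983, Ch. 13, Schwarzschild observers] -/
theorem dev_timeOrientation :
    (staticVacuumCauchyDevelopment M hM).timeOrientation = staticTimeOrientation M := rfl

/-- The embedding of the development is the slice embedding `y ↦ (0, y)` (by `rfl`). [cite: Ringstrom2009, Def. 16.2] -/
@[simp]
theorem dev_embed : (staticVacuumCauchyDevelopment M hM).embed = staticSliceEmbed M := rfl

/-- The normal of the development is `N = (1 − 2M/r)^{-1/2} ∂_t` (by `rfl`). [cite: Wald1984, §10.2] -/
@[simp]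
theorem dev_normal : (staticVacuumCauchyDevelopment M hM).normal = staticSliceNormal M := rfl

/-- The spacetime of the underlying Cauchy development is the static spacetime `staticSpacetime M`
(by `rfl`; restated at the `CauchyDevelopment` projection used below). [cite: Ringstrom2009, Def. 16.2] -/
theorem staticVacuumCauchyDevelopment_toCauchyDevelopment_toSpacetime :
    (staticVacuumCauchyDevelopment M hM).toCauchyDevelopment.toSpacetime = staticSpacetime M := rfl

/-- The development is vacuum as a data embedding (`DataEmbedding.IsVacuum`). Ringström 2009, Def. 16.3.
[cite: Ringstrom2009, Def. 16.3] -/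
theorem staticVacuumCauchyDevelopment_isVacuum :
    (staticVacuumCauchyDevelopment M hM).toDataEmbedding.IsVacuum :=
  (staticVacuumCauchyDevelopment M hM).isVacuum

/-- **Non-vacuity at positive mass**: the time-symmetric Schwarzschild data have a vacuum Cauchy
development (compare `nonempty_vacuumCauchyDevelopment_trivialData` at `M = 0`).
[cite: Ringstrom2009, Def. 16.3] -/
theorem nonempty_vacuumCauchyDevelopment_staticSliceData :
    Nonempty (VacuumCauchyDevelopment (staticSliceData M hM.le)) :=
  ⟨staticVacuumCauchyDevelopment M hM⟩

end Projections

/-! ### Development level: the typed quasi-final late-chart clauses over `𝒟₁ := staticVacuumCauchyDevelopment M hM` -/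

section Development

variable [Kerr.Facts] [Kerr.SliceFacts] {r₀ : ℝ}

/-- **Def. 4.4 (1)+(2) with the §4.1 rest frame, at the development level**: the areal late chart
`Schwarzschild.lateChart` of the vacuum Cauchy development `𝒟₁ := staticVacuumCauchyDevelopment M hM`
satisfies `IsQuasiFinalAnalytic` in the signature `(𝓡 4) (M := 𝒟₁.carrier) 𝒟₁.metric.val`, every
`r₀ > 0`, `r₀ ≥ 4|M|`, `T̲`. [cite: Ellithy2026, Def. 4.4 p. 39] -/
theorem dev_isQuasiFinalAnalytic (hM : 0 < M) (hr₀ : 0 < r₀) (hm : 4 * |M| ≤ r₀) (Tlo : ℝ) :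
    IsQuasiFinalAnalytic (𝓡 4) (M := (staticVacuumCauchyDevelopment M hM).toCauchyDevelopment.carrier)
      (staticVacuumCauchyDevelopment M hM).toCauchyDevelopment.metric.val (lateChart M r₀ hr₀ hm) Tlo r₀ :=
  staticMetric_isQuasiFinalAnalytic hr₀ hm Tlo

/-- **The collar sentence of Def. 4.4 (1) at the development level** (`HasUniformCollarControl` over
`𝒟₁ := staticVacuumCauchyDevelopment M hM`), every `r₀ > 0`, `r₀ ≥ 4|M|`, `T̲`.
[cite: Ellithy2026, Def. 4.4 p. 39] -/
theorem dev_hasUniformCollarControl (hM : 0 < M) (hr₀ : 0 < r₀) (hm : 4 * |M| ≤ r₀) (Tlo : ℝ) :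
    HasUniformCollarControl (𝓡 4) (M := (staticVacuumCauchyDevelopment M hM).toCauchyDevelopment.carrier)
      (staticVacuumCauchyDevelopment M hM).toCauchyDevelopment.metric.val (lateChart M r₀ hr₀ hm) Tlo r₀ :=
  staticMetric_hasUniformCollarControl hr₀ hm Tlo

/-- **Def. 4.4 (1)+(2), §4.1 rest frame and the collar sentence together, at the development level**
(`IsQuasiFinalAnalyticCollar` over `𝒟₁ := staticVacuumCauchyDevelopment M hM`), every `r₀ > 0`,
`r₀ ≥ 4|M|`, `T̲`. [cite: Ellithy2026, Def. 4.4 p. 39] -/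
theorem dev_isQuasiFinalAnalyticCollar (hM : 0 < M) (hr₀ : 0 < r₀) (hm : 4 * |M| ≤ r₀) (Tlo : ℝ) :
    IsQuasiFinalAnalyticCollar (𝓡 4)
      (M := (staticVacuumCauchyDevelopment M hM).toCauchyDevelopment.carrier)
      (staticVacuumCauchyDevelopment M hM).toCauchyDevelopment.metric.val (lateChart M r₀ hr₀ hm) Tlo r₀ :=
  staticMetric_isQuasiFinalAnalyticCollar hr₀ hm Tlo

/-- The ADM form (4.6) of the areal tuple `TailClassModel.schwarzschildAreal M` for the development's metric in the late
chart, every `r₀ > 0`, `r₀ ≥ 4|M|`, `T̲`. [cite: Ellithy2026, Def. 4.4 (4.6) p. 39] -/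
theorem dev_hasADMForm (hM : 0 < M) (hr₀ : 0 < r₀) (hm : 4 * |M| ≤ r₀) (Tlo : ℝ) :
    HasADMForm (𝓡 4) (M := (staticVacuumCauchyDevelopment M hM).toCauchyDevelopment.carrier)
      (staticVacuumCauchyDevelopment M hM).toCauchyDevelopment.metric.val (lateChart M r₀ hr₀ hm) Tlo r₀
      (TailClassModel.schwarzschildAreal M) :=
  staticMetric_hasADMForm hr₀ hm Tlo

/-- **The §4.1 orientation clause at the development level**: the late chart's time is the Cauchy
temporal function `t` (static time) of `𝒟₁ := staticVacuumCauchyDevelopment M hM`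
(`IsQuasiFinalTemporalChart` in the signature `𝒟₁.metric 𝒟₁.timeOrientation`), every `r₀ > 0`,
`r₀ ≥ 4|M|`, `T̲`. [cite: Ellithy2026, §4.1 p. 38] -/
theorem dev_isQuasiFinalTemporalChart (hM : 0 < M) (hr₀ : 0 < r₀) (hm : 4 * |M| ≤ r₀) (Tlo : ℝ) :
    IsQuasiFinalTemporalChart (staticVacuumCauchyDevelopment M hM).toCauchyDevelopment.metric
      (staticVacuumCauchyDevelopment M hM).toCauchyDevelopment.timeOrientation
      (fun x : Kerr.exterior M 0 ↦ E4.time (x : E4)) (lateChart M r₀ hr₀ hm) Tlo r₀ :=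
  staticMetric_isQuasiFinalTemporalChart hM hr₀ hm Tlo

/-- Every level `{t = c}` of static time is a Cauchy hypersurface of the development
`𝒟₁ := staticVacuumCauchyDevelopment M hM` (O'Neill 1983, Exercise 14.6).
[cite: ONeillSemiRiemannian1983, Ch. 14, Def. 14.28 (p. 415), Exercise 6] -/
theorem dev_isCauchyHypersurface_level_time (hM : 0 < M) (c : ℝ) :
    (staticVacuumCauchyDevelopment M hM).toCauchyDevelopment.metric.IsCauchyHypersurface
      (staticVacuumCauchyDevelopment M hM).toCauchyDevelopment.timeOrientation
      ((fun x : Kerr.exterior M 0 ↦ E4.time (x : E4)) ⁻¹' {c}) :=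
  isCauchyHypersurface_level_time hM c

/-- **End-to-end at the development level**: the far label lines `u ↦ Φ(u, r, p)`, `r ≥ R`, of the late
chart are future-directed timelike curves for `𝒟₁.timeOrientation` on `(T̲, ∞)` with
`g_static(γ̇, γ̇) ≤ -c₀`, `𝒟₁ := staticVacuumCauchyDevelopment M hM`, every `r₀ > 0`, `r₀ ≥ 4|M|`, `T̲`.
[cite: Ellithy2026, §4.1 p. 38; Def. 4.4 p. 39] -/
theorem dev_labelLine_isFutureTimelikeCurveOn (hM : 0 < M) (hr₀ : 0 < r₀) (hm : 4 * |M| ≤ r₀) (Tlo : ℝ) :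
    ∃ R c₀ : ℝ, r₀ < R ∧ 0 < c₀ ∧ ∀ (r : ℝ) (p : Metric.sphere (0 : E3) 1), R ≤ r →
      (staticVacuumCauchyDevelopment M hM).toCauchyDevelopment.metric.IsFutureTimelikeCurveOn
        (staticVacuumCauchyDevelopment M hM).toCauchyDevelopment.timeOrientation
        (fun u : ℝ ↦ (lateChart M r₀ hr₀ hm (u, r, p) :
          (staticVacuumCauchyDevelopment M hM).toCauchyDevelopment.carrier))
        (Ioi Tlo) ∧
      ∀ u : ℝ, Tlo < u →
        (staticVacuumCauchyDevelopment M hM).toCauchyDevelopment.metric.val (lateChart M r₀ hr₀ hm (u, r, p))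
          (velocity (𝓡 4)
            (fun u : ℝ ↦ (lateChart M r₀ hr₀ hm (u, r, p) :
              (staticVacuumCauchyDevelopment M hM).toCauchyDevelopment.carrier)) u)
          (velocity (𝓡 4)
            (fun u : ℝ ↦ (lateChart M r₀ hr₀ hm (u, r, p) :
              (staticVacuumCauchyDevelopment M hM).toCauchyDevelopment.carrier)) u)
        ≤ -c₀ :=
  staticMetric_labelLine_isFutureTimelikeCurveOn hM hr₀ hm Tlo

end Development

end Schwarzschild

end Literature.Geometry.Lorentzian

end
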